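import Summits.BirchSwinnertonDyer.Rank1Residual.Additive.GordCycRankOneLambda
import Summits.BirchSwinnertonDyer.Rank1Residual.Additive.GordThreeDelbourgo2002Bridge
import HarnessLib

/-!
# O7-ord / N10 at `p = 3` on the (G)-ordinary cell (Gord3 = (G-ord, e = 2) at 3): the `r_an ≤ 1`
# class forms of the typed Eisenstein half `CycLowerBoundAt` and of the λ-certificate lever, with
# Delbourgo 2002 Thm. (A)+(B) AT `p = 3` (n1011-p16's `Delbourgo2002.mainTheorem_three`) as the binder
# (cell `b2b-bsdres`, team n1011, seat p01, OWNERS row T-O7)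

HONEST FRAMING (cell `b2b-bsdres`, run/shared/lean/b2b/bsd-rank1-residual/, verbatim in every
file): prove what is provable now; shrink each hard class to its core with data; no claim beyond
stated classes. Research routes; census output = EVIDENCE / conjecture items, never a Literature
fact; RESIDUAL-MAP marks change only by signed lines. §I O7 stays OPEN, N10 stays CONSTRUCTION;
X3♯(G-ord)/X4♯(G-ord) stay CONSTRUCTION-SHAPED; nothing is booked; no label changes. COVERAGE
(stated first, referee 1 proviso): `p = 3`, `E` additive at 3 of type (G)-ordinary (`TypeGOrd W 3`:
good ORDINARY reduction over a subfield of `ℚ(ζ₃) = ℚ(√−3)` above 3 — Delbourgo's Hypothesis, second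
bullet, "potentially ordinary at `p = 3` with semistable reduction over a quadratic extension of
`ℚ₃`", JNT 95 (2002) p. 39), `E` WITHOUT CM (explicit binder), reduction NON-anomalous over the
(G)-field for the lower half (Delbourgo's `ℓ_3(E) ∈ {3, 9}` on the anomalous rows is kept as `+ ord₃ ℓ`
elsewhere); binder = n1011-p16's Literature fact `Delbourgo2002.mainTheorem_three` (reviewed
print-faithful by n1011-lit, 2026-08-21T05:42Z) through p16's bridge `TypeGOrd.delbourgo2002_three`.
This closes the `p = 3` coverage gap of `GordCycLowerBoundClass.lean` / `CycRankOneLambdaClass.lean`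
on the (G-ord) side ((M) at 3 was already covered by `mainTheorem_potMult`); the potentially
SUPERSINGULAR rows at 3 (O7-ss / O5 / O6) are untouched. The rank-`0` consumer at 3 in additive-p2's
currency is n1011-p18's row (T-b2c-BR) and is NOT restated here. HONESTY RIDER (λ-lever): by
`padicVal_identity_of_charLamLe` the regulator certificate below holds at a BSD-true pair iff
`μ(fE) = 0`; what the λ-certificate gives unconditionally is the Schneider rider and `#Ш[3^∞] < ∞`.
Theorems only; no definition, no named fact, no `_holds`.

References: [Delbourgo2002] Thm. (A), (B) (p. 40), Hypothesis (p. 39), Remark p. 53 (`p = 3`);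
[Washington1997] §7.1; [Miller2011LMS] Def. 1.1.
-/

noncomputable section

open scoped Classical NumberField

open WeierstrassCurve NumberField Literature.NumberTheory.EllipticCurves
  Literature.NumberTheory.EllipticCurves.Rank1Residual
  Literature.NumberTheory.EllipticCurves.Rank1Residual.Typed
  Literature.NumberTheory.EllipticCurves.Delbourgo2002
  IsDedekindDomain

namespace Summit.BirchSwinnertonDyer.Rank1Residual.Additive

variable {W : WeierstrassCurve ℚ} [W.IsElliptic] [W.IsGloballyMinimal] [hp : Fact (Nat.Prime 3)]

/-! ### The typed Eisenstein half at `p = 3` on (G-ord) -/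

/-- **(G-ord)@3, `r_an ≤ 1`, non-CM, non-anomalous: the lower half from the typed input.** IF every
height datum with Delbourgo's (B)-clauses has non-degenerate regulator (rider; idle in rank `0`) and
satisfies `CycLowerBoundAt W 3 Dh`, THEN `Typed.MissingLowerBoundAt W 3` — Delbourgo 2002 (A)+(B) at
`p = 3` (`hDel3`, explicit) via p16's bridge, GZK. [cite: Delbourgo2002, Theorem (A), (B) (p. 40), Hypothesis (p. 39)]
[cite: Miller2011LMS, Def. 1.1] -/
theorem TypeGOrd.missingLowerBoundAt_three_rankLeOne_of_cycLowerBound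
    (hDel3 : Delbourgo2002.mainTheorem_three) (hGZK : rank_eq_analyticRank_of_analyticRank_le_one)
    (hG : TypeGOrd W 3) (hadd : Addv W 3) (hcm : ¬ W.HasCM) (hr : W.analyticRank ≤ 1)
    (hna : ReductionNonAnomalous W 3)
    (hlow : ∀ Dh : PAdicHeightData W 3, LeadingTermClauses W 3 Dh →
      SchneiderConjecture Dh ∧ CycLowerBoundAt W 3 Dh) :
    MissingLowerBoundAt W 3 := by
  obtain ⟨hA, Dh, hB⟩ := hG.delbourgo2002_three hDel3 hadd hcm
  obtain ⟨hS, hlowDh⟩ := hlow Dh hB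
  exact missingLowerBoundAt_of_cycLowerBound W 3 hB hS hA hGZK hr hna hlowDh

/-- **(G-ord)@3, `r_an = 0`: no rider** (regulator `= 1`). [cite: Delbourgo2002, Theorem (A), (B) (p. 40)]
[cite: Miller2011LMS, Def. 1.1] -/
theorem TypeGOrd.missingLowerBoundAt_three_rankZero_of_cycLowerBound
    (hDel3 : Delbourgo2002.mainTheorem_three) (hGZK : rank_eq_analyticRank_of_analyticRank_le_one)
    (hG : TypeGOrd W 3) (hadd : Addv W 3) (hcm : ¬ W.HasCM) (hr : W.analyticRank = 0)
    (hna : ReductionNonAnomalous W 3)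
    (hlow : ∀ Dh : PAdicHeightData W 3, LeadingTermClauses W 3 Dh → CycLowerBoundAt W 3 Dh) :
    MissingLowerBoundAt W 3 := by
  obtain ⟨hA, Dh, hB⟩ := hG.delbourgo2002_three hDel3 hadd hcm
  exact missingLowerBoundAt_rankZero_of_cycLowerBound W 3 hB hA hGZK hr hna (hlow Dh hB)

/-- **(G-ord)@3, `iff` for a given datum**: with the (B)-clauses for `Dh`, the rider, (A) (from
`hDel3`), GZK, modularity, `r_an ≤ 1`, non-anomalous: `CycLowerBoundAt W 3 Dh ↔ MissingLowerBoundAt W 3`.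
[cite: Delbourgo2002, Theorem (A), (B) (p. 40)] [cite: Miller2011LMS, Def. 1.1] -/
theorem TypeGOrd.cycLowerBoundAt_three_iff_missingLowerBoundAt
    (hDel3 : Delbourgo2002.mainTheorem_three) (hGZK : rank_eq_analyticRank_of_analyticRank_le_one)
    (hmod : hasEntireLFunction_rat) (hG : TypeGOrd W 3) (hadd : Addv W 3) (hcm : ¬ W.HasCM)
    (hr : W.analyticRank ≤ 1) (hna : ReductionNonAnomalous W 3)
    {Dh : PAdicHeightData W 3} (hB : LeadingTermClauses W 3 Dh) (hS : SchneiderConjecture Dh) :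
    CycLowerBoundAt W 3 Dh ↔ MissingLowerBoundAt W 3 :=
  cycLowerBoundAt_iff_missingLowerBoundAt W 3 hB hS (hG.delbourgo2002_three hDel3 hadd hcm).1 hGZK hmod
    hr hna

/-- **X4♯(G-ord)@3, `r_an ≤ 1`: the lower half from the typed input** (`ClassX4Gord = ClassX4 ∧ TypeGOrd`).
[cite: Delbourgo2002, Theorem (A), (B) (p. 40)] [cite: Miller2011LMS, Def. 1.1] -/
theorem ClassX4Gord.missingLowerBoundAt_three_rankLeOne_of_cycLowerBound
    (hDel3 : Delbourgo2002.mainTheorem_three) (hGZK : rank_eq_analyticRank_of_analyticRank_le_one)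
    (hX : ClassX4Gord W 3) (hcm : ¬ W.HasCM) (hr : W.analyticRank ≤ 1)
    (hna : ReductionNonAnomalous W 3)
    (hlow : ∀ Dh : PAdicHeightData W 3, LeadingTermClauses W 3 Dh →
      SchneiderConjecture Dh ∧ CycLowerBoundAt W 3 Dh) :
    MissingLowerBoundAt W 3 :=
  hX.2.missingLowerBoundAt_three_rankLeOne_of_cycLowerBound hDel3 hGZK hX.1.2.1 hcm hr hna hlow

/-- **X3♯(G-ord)@3, `r_an ≤ 1`: the lower half from the typed input** (`ClassX3Gord = ClassX3 ∧ TypeGOrd`;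
reducible `E[3]`). [cite: Delbourgo2002, Theorem (A), (B) (p. 40)] [cite: Miller2011LMS, Def. 1.1] -/
theorem ClassX3Gord.missingLowerBoundAt_three_rankLeOne_of_cycLowerBound
    (hDel3 : Delbourgo2002.mainTheorem_three) (hGZK : rank_eq_analyticRank_of_analyticRank_le_one)
    (hX : ClassX3Gord W 3) (hcm : ¬ W.HasCM) (hr : W.analyticRank ≤ 1)
    (hna : ReductionNonAnomalous W 3)
    (hlow : ∀ Dh : PAdicHeightData W 3, LeadingTermClauses W 3 Dh →
      SchneiderConjecture Dh ∧ CycLowerBoundAt W 3 Dh) :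
    MissingLowerBoundAt W 3 :=
  hX.2.missingLowerBoundAt_three_rankLeOne_of_cycLowerBound hDel3 hGZK hX.1.2 hcm hr hna hlow

/-! ### The λ-certificate lever at `p = 3` on (G-ord) -/

/-- **(G-ord)@3, non-CM: the λ-certificate gives the Schneider rider for every (B)-datum AND
`#Ш(E/ℚ)[3^∞] < ∞`** (any rank; Delbourgo 2002 (A)+(B) at 3 via p16's bridge).
[cite: Delbourgo2002, Theorem (A), (B) (p. 40)] [cite: Washington1997, §7.1] -/
theorem TypeGOrd.schneider_and_finite_three_of_charLamLe (hDel3 : Delbourgo2002.mainTheorem_three)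
    (hG : TypeGOrd W 3) (hadd : Addv W 3) (hcm : ¬ W.HasCM) (hlam : CharLamLeAt W 3 W.mordellWeilRank) :
    (∀ Dh : PAdicHeightData W 3, LeadingTermClauses W 3 Dh → SchneiderConjecture Dh) ∧
      Finite (AddCommGroup.primaryComponent W.sha 3) := by
  obtain ⟨hA, Dh, hB⟩ := hG.delbourgo2002_three hDel3 hadd hcm
  exact ⟨fun Dh' hB' ↦ (schneider_and_finite_of_charLamLe W 3 hB' hA hlam).1,
    (schneider_and_finite_of_charLamLe W 3 hB hA hlam).2⟩

/-- **(G-ord)@3, non-CM, non-anomalous, `r_an ≤ 1`: the per-pair LOWER half from the λ-certificate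
and ONE regulator valuation** (`ord₃ Reg₃(Dh) + ord₃ #Ш_an + ord₃ ∏c ≤ rank + 2·ord₃ #tors` for the
(B)-data; honest rider: at a BSD-true pair this holds iff `μ(fE) = 0`).
[cite: Delbourgo2002, Theorem (A), (B) (p. 40)] [cite: Miller2011LMS, Def. 1.1] -/
theorem TypeGOrd.missingLowerBoundAt_three_of_charLamLe_of_regulatorCertificate
    (hDel3 : Delbourgo2002.mainTheorem_three) (hGZK : rank_eq_analyticRank_of_analyticRank_le_one)
    (hG : TypeGOrd W 3) (hadd : Addv W 3) (hcm : ¬ W.HasCM) (hr : W.analyticRank ≤ 1)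
    (hna : ReductionNonAnomalous W 3) (hlam : CharLamLeAt W 3 W.mordellWeilRank)
    {s : ℚ} (hs : shaAn W = (s : ℂ))
    (hcert : ∀ Dh : PAdicHeightData W 3, LeadingTermClauses W 3 Dh →
      (padicRegulator Dh).valuation + padicValRat 3 s + padicValNat 3 W.tamagawaProduct ≤
        (W.mordellWeilRank : ℤ) + 2 * padicValNat 3 W.torsionOrder) :
    MissingLowerBoundAt W 3 := by
  obtain ⟨hA, Dh, hB⟩ := hG.delbourgo2002_three hDel3 hadd hcm
  exact missingLowerBoundAt_of_charLamLe_of_regulatorCertificate W 3 hB hA hGZK hr (by decide) hna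
    hlam hs (hcert Dh hB)

/-- **(G-ord)@3: the typed Eisenstein half with the rider REPLACED by the λ-certificate** (`r_an ≤ 1`,
non-CM, non-anomalous). [cite: Delbourgo2002, Theorem (A), (B), (C) (p. 40)] [cite: Miller2011LMS, Def. 1.1] -/
theorem TypeGOrd.missingLowerBoundAt_three_of_cycLowerBound_of_charLamLe
    (hDel3 : Delbourgo2002.mainTheorem_three) (hGZK : rank_eq_analyticRank_of_analyticRank_le_one)
    (hG : TypeGOrd W 3) (hadd : Addv W 3) (hcm : ¬ W.HasCM) (hr : W.analyticRank ≤ 1)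
    (hna : ReductionNonAnomalous W 3) (hlam : CharLamLeAt W 3 W.mordellWeilRank)
    (hlow : ∀ Dh : PAdicHeightData W 3, LeadingTermClauses W 3 Dh → CycLowerBoundAt W 3 Dh) :
    MissingLowerBoundAt W 3 := by
  obtain ⟨hA, Dh, hB⟩ := hG.delbourgo2002_three hDel3 hadd hcm
  exact missingLowerBoundAt_of_cycLowerBound_of_charLamLe W 3 hB hA hGZK hr hna hlam (hlow Dh hB)

end Summit.BirchSwinnertonDyer.Rank1Residual.Additive

end
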